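import Literature.NumberTheory.Automorphic.CDTTheorem722
import Literature.NumberTheory.EllipticCurves.Szpiro
import Literature.NumberTheory.DiophantineGeometry.LocalReduction
import Literature.NumberTheory.DiophantineGeometry.GeneralizedFermatTwoPowerCoefficientMazurTorsionProofs
import Mathlib.FieldTheory.Finite.GaloisField
import HarnessLib

/-!
# Stub ideation k3 · GEN 5 · `stub_liftThree` (crux `FreyModularity`, stmt-ABC-11340, line `Sketch`)

HOME FAMILY 3 — PROBE THE EXTREMES.  Companion (elaboration sanity only; every `sorry` below is a
PROPOSED HELPER LEMMA, none is registered, nothing here touches the skeleton `Lines/Sketch.lean`).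
Imports kept minimal (the farm snapshot had `…StubFreyCaseBSixteen` unbuilt at writing time); the S6 /
S11 / S12 / S17 theorems named in the docstrings live in `DefiniteXiFreyModularityStubFreySwanOdd`,
`…StubSwanOddNonabelian`, `…StubFreyCaseBSixteen`, `…StubFreyCaseBAllPairs`.

The extreme probed in this generation is the **input extreme** of the stub: which of the
hypotheses Diamond 1996 REMOVED from Wiles 1995 does the composition `isModular_freyCurve_of_stubs`
actually exercise?  Wiles 1995, Thm. 0.2 (p. 447) = the stub's statement PLUS the vexing-prime
hypothesis **(ii)**: *if `q ≡ -1 (mod 3)` is ramified in `ρ̄` then `ρ̄|D_q` is reducible over `𝔽̄₃`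
or `ρ̄|I_q` is absolutely irreducible*.  The census (`STUB-IDEAS-stub_liftThree-3.md`): on branch (a)
(`W = E_(a,b)`) hypothesis (ii) HOLDS at every `q` — odd `q`: `E` semistable (`H0`, `H2`); `q = 2`:
the additive Frey classes have `Q₈ ⊆ ρ̄_{E,3}(I_2)` (`S6 + S11`, `H3`), the others are semistable at
`2` up to the `-1` twist (`H2` + framed twist) — and on branch (b) (`W'` from `stub_switch`, UNCHANGED) it holds
at every odd `q ≠ 5` (`H1`: semistability transfers through `E[5] ≅ W'[5]`, then `H2`), at `q = 2`
(the same after the `-1` twist, `H4`), and at `q = 5` for EVERY elliptic curve over `ℚ` (`F3`/`H7`: at a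
prime `q ≡ 5 (mod 12)` the image of inertia in `SL₂(𝔽₃)` is cyclic, `⟨t⟩`, Frobenius conjugates `t`
to `t^q = t^{±5}`, and a finite check in `GL₂(𝔽₃)` then produces a common eigenvector over `𝔽₉` —
Diamond–Kramer's appendix: type **V** at odd `q` needs `e = 4` and `μ₄ ⊄ ℚ_q`, i.e. `q ≡ 11 (mod 12)`).
So the Diamond-1996 surplus of the stub (removal of (ii)) is consumed NOWHERE by the composition:
S1b may be weakened to Wiles–Taylor–Wiles 1995 verbatim (`LiftThreeWiles`) at the price of the
curve-side lemmas H0–H7 below, all routed through landed tree theorems; S3 stays as registered.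

[cite: Wiles1995, Thm. 0.2 (ii), Thm. 0.3 (iii) (p. 447); Thm. 5.3 and pp. 543–544]
[cite: Diamond1996, Thm. 1.1 (removal of (ii))] [cite: DiamondKramer1995, Lemmas 1–3]
-/

set_option linter.dupNamespace false
set_option linter.unusedVariables false

open scoped MatrixGroups NumberField Pointwise
open Matrix Field IsDedekindDomain
open Literature.NumberTheory.EllipticCurves
open Literature.NumberTheory.Automorphic
open Literature.NumberTheory.Automorphic.BCDT
open Literature.NumberTheory.GaloisRepresentations
open WeierstrassCurve
open Literature.NumberTheory.DiophantineGeometry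

attribute [local instance] AddSubgroup.torsionBy.zmodModule

noncomputable section

namespace Summit.ABC.ABC.Cruxes.FreyModularity.StubIdeas3G5

/-! ## D — the typed vexing-prime hypothesis (Wiles 1995 Thm. 0.2 (ii) at `p = 3`) -/

/-- `ρ̄(S)` has a common eigenvector over `𝔽₉` (for a subgroup image `ρ̄(S) ≤ GL₂(𝔽₃)` this is
"reducible over `𝔽̄₃`": eigenvalues of elements of `GL₂(𝔽₃)` live in `𝔽₉`). -/
def HasCommonEigenvectorOn (ρ : ModPGaloisRep ℚ (ZMod 3) 2) (S : Set (absoluteGaloisGroup ℚ)) :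
    Prop :=
  ∃ w : Fin 2 → GaloisField 3 2, w ≠ 0 ∧ ∀ σ ∈ S, ∃ c : GaloisField 3 2,
    (((ρ σ : GL (Fin 2) (ZMod 3)) : Matrix (Fin 2) (Fin 2) (ZMod 3)).map
        (algebraMap (ZMod 3) (GaloisField 3 2))) *ᵥ w = c • w

/-- **Wiles' hypothesis (ii) of Thm. 0.2 / (iii) of Thm. 0.3 at `p = 3`**: for every rational prime
`q ≡ -1 (mod 3)` there is a prime `𝔓 ∣ q` of `ℤ̄` at which `ρ̄` is unramified, or `ρ̄(D_𝔓)` has a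
common eigenvector over `𝔽₉`, or `ρ̄(I_𝔓)` has none (= `ρ̄|I_q` absolutely irreducible).
(`D_𝔓 = MulAction.stabilizer Γ_ℚ 𝔓`, `I_𝔓 = 𝔓.inertia Γ_ℚ`; one `𝔓` suffices, the condition is
conjugation-invariant.) [cite: Wiles1995, Thm. 0.2 (ii), p. 447] -/
def WilesVexingHyp (ρ : ModPGaloisRep ℚ (ZMod 3) 2) : Prop :=
  ∀ v : HeightOneSpectrum (𝓞 ℚ), (Rat.HeightOneSpectrum.primesEquiv v : ℕ) % 3 = 2 →
    ∃ 𝔓 ∈ v.primesAbove,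
      (∀ σ ∈ 𝔓.inertia (absoluteGaloisGroup ℚ), ρ σ = 1) ∨
      HasCommonEigenvectorOn ρ (MulAction.stabilizer (absoluteGaloisGroup ℚ) 𝔓) ∨
      ¬ HasCommonEigenvectorOn ρ (𝔓.inertia (absoluteGaloisGroup ℚ))

/-- **S1b♭ = Wiles 1995 Thm. 0.2 at `p = 3` on `ρ_{E,3}`, verbatim** (the registered stub PLUS
`WilesVexingHyp`): the weakest printed R = T statement the composition needs on branch (a), and on
branch (b) (H5, H6). [cite: Wiles1995, Thm. 0.2, Thm. 0.3] -/
def LiftThreeWiles : Prop :=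
  ∀ (W : WeierstrassCurve ℚ) [W.IsElliptic] (ρ : ModPGaloisRep ℚ (ZMod 3) 2),
    W.IsTorsionGaloisRep 3 ρ → ρ.IsAbsIrreducibleOverSqrt (-3) → ¬ 9 ∣ W.conductorNorm ℤ →
    WilesVexingHyp ρ → ρ.IsModular → W.IsModularGaloisRepTate 3

/-- The registered stub (Diamond 1996 generality), as a `Prop` (verbatim copy of
`Sketch.stub_liftThree`'s statement, for the comparison lemma only). -/
def LiftThree : Prop :=
  ∀ (W : WeierstrassCurve ℚ) [W.IsElliptic] (ρ : ModPGaloisRep ℚ (ZMod 3) 2),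
    W.IsTorsionGaloisRep 3 ρ → ρ.IsAbsIrreducibleOverSqrt (-3) → ¬ 9 ∣ W.conductorNorm ℤ →
    ρ.IsModular → W.IsModularGaloisRepTate 3

/-- The stub implies its Wiles-1995 restriction (the extra hypothesis is simply dropped). -/
theorem liftThreeWiles_of_liftThree (h : LiftThree) : LiftThreeWiles :=
  fun W _ ρ hρ h3i h9 _ hmod ↦ h W ρ hρ h3i h9 hmod

/-! ## F — finite facts in `M₂(𝔽₃)` / `𝔽₉²` (S each) -/

/-- **F1.** Two matrices of `SL₂(𝔽₃)` with a common eigenvector in `𝔽₉²` commute.  (If the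
eigenvector is an `𝔽₃`-line both lie in the Borel `∩ SL₂(𝔽₃) ≅ C₆`; otherwise its Frobenius
conjugate is a second common eigenvector and both are diagonal in that `𝔽₉`-basis.)  Contrapositive:
a non-commuting pair of inertia elements (S11) leaves NO common eigenvector — `ρ̄|I` absolutely
irreducible. -/
theorem commute_of_hasCommonEigenvector (A B : Matrix (Fin 2) (Fin 2) (ZMod 3))
    (hA : A.det = 1) (hB : B.det = 1) (w : Fin 2 → GaloisField 3 2) (hw : w ≠ 0)
    (cA cB : GaloisField 3 2)
    (hAw : (A.map (algebraMap (ZMod 3) (GaloisField 3 2))) *ᵥ w = cA • w)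
    (hBw : (B.map (algebraMap (ZMod 3) (GaloisField 3 2))) *ᵥ w = cB • w) :
    A * B = B * A := by
  sorry

/-- **F2.** If `g ∈ GL₂(𝔽₃)` normalises the group generated by a non-trivial unipotent `u`
(`u ≠ 1`, `(u - 1)² = 0`) then `g` preserves the fixed line of `u`: a fixed vector `e ≠ 0` of `u`
is an eigenvector of `g`.  (Used at multiplicative primes: `D_𝔓` normalises `I_𝔓`, whose image is
`⟨u⟩` of order `3`.) -/
theorem eigvec_of_normalises_unipotent (g u : Matrix (Fin 2) (Fin 2) (ZMod 3))
    (hg : IsUnit g.det) (hu1 : u ≠ 1) (hu : (u - 1) * (u - 1) = 0)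
    (hnorm : ∃ k : ℕ, g * u = u ^ k * g) (e : Fin 2 → ZMod 3) (he : e ≠ 0) (hue : u *ᵥ e = e) :
    ∃ c : ZMod 3, g *ᵥ e = c • e := by
  sorry

/-- **F3 — no vexing at `q ≡ 5 (mod 12)` (finite check in `GL₂(𝔽₃)`, verified by brute force over
`𝔽₉ = 𝔽₃[i]` at writing: 0 counterexamples for exponents `5` and `17`; 48 for exponent `11`).**  If
`t ∈ SL₂(𝔽₃)` (image of a generator of tame inertia; `det ρ̄ = χ̄₃` is unramified at `q ≠ 3`) and
`g ∈ GL₂(𝔽₃)` (a Frobenius) satisfy the tame relation `g t g⁻¹ = t^q` with `q ≡ 5 (mod 12)`, then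
`t = 1` or `t, g` have a common eigenvector in `𝔽₉²`.  (By hand: `ord t ∣ 4 ⇒ t^q = t`, so `g`
commutes with the semisimple `t`; `ord t ∈ {3, 6} ⇒ t = ±u` unipotent and F2; `ord t = 8` is
incompatible with `t^q ∼ t`.)  Diamond–Kramer (CSS 1997, appendix, Prop. 0.3): type **V** at odd `q`
for `ℓ = 3` iff `e = 4` and `μ₄ ⊄ ℚ_q`. [cite: CornellSilvermanStevens1997, Diamond, An extension of Wiles' results, appendix (with Kramer), Prop. 0.3] -/
theorem eq_one_or_hasCommonEigenvector_of_tame_relation (t g : Matrix (Fin 2) (Fin 2) (ZMod 3))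
    (ht : t.det = 1) (hg : IsUnit g.det) {q : ℕ} (hq : q % 12 = 5) (hrel : g * t = t ^ q * g) :
    t = 1 ∨ ∃ w : Fin 2 → GaloisField 3 2, w ≠ 0 ∧
      (∃ c : GaloisField 3 2, (t.map (algebraMap (ZMod 3) (GaloisField 3 2))) *ᵥ w = c • w) ∧
      (∃ c : GaloisField 3 2, (g.map (algebraMap (ZMod 3) (GaloisField 3 2))) *ᵥ w = c • w) := by
  sorry

/-! ## H — the census lemmas (curve side; S/M each, all from landed tree theorems) -/

/-- **H0 (S).** A Frey curve is semistable at every odd prime: `p² ∤ N(E_(a,b))` for odd primes `p`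
(`conductorNorm_freyCurve_dvd_holds : N ∣ 2⁸·rad(ab(a+b))` + square-freeness of the radical; the
skeleton's `not_twentyFive_dvd_conductorNorm_freyCurve` is the case `p = 5`, same proof). -/
theorem not_sq_dvd_conductorNorm_freyCurve_of_odd {a b : ℤ} (hab : IsCoprime a b)
    (h0 : a * b * (a + b) ≠ 0) {p : ℕ} (hp : p.Prime) (hp2 : p ≠ 2) :
    ¬ p ^ 2 ∣ (freyCurve a b).conductorNorm ℤ := by
  sorry

/-- **H1 (S) — semistability transfers through a mod-`ℓ` congruence, `ℓ ≥ 5`, at `v ∤ ℓ`**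
(= `stub_nineTransfer` with the place `3` replaced by any `v ∤ ℓ`; same three tree inputs:
`exists_ne_zero_smul_eq_of_not_hasAdditiveReductionAt`, `exists_torsion_of_isTorsionGaloisRep`,
`stub_nineTransfer_torsion`).  [cite: CornellSilvermanStevens1997, Silverberg Ch. VI Prop. 7.1]
[cite: Wiles1995, p. 543: "E' is semistable at q ⟺ #ρ̄_{E',5}(I_q) ∣ 5"] -/
theorem not_hasAdditiveReductionAt_of_isTorsionGaloisRep (W W' : WeierstrassCurve ℚ) [W.IsElliptic]
    [W'.IsElliptic] {ℓ : ℕ} [Fact ℓ.Prime] (hℓ4 : 4 < ℓ) {ρ : ModPGaloisRep ℚ (ZMod ℓ) 2}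
    (hρ : W.IsTorsionGaloisRep ℓ ρ) (hρ' : W'.IsTorsionGaloisRep ℓ ρ) {v : HeightOneSpectrum (𝓞 ℚ)}
    (hv : (ℓ : 𝓞 ℚ) ∉ v.asIdeal) (hW : ¬ W.HasAdditiveReductionAt v) :
    ¬ W'.HasAdditiveReductionAt v := by
  sorry

/-- **H1' (S) — conductor form of H1** (`sq_dvd_conductorNorm_iff_hasAdditiveReductionAt`). -/
theorem not_sq_dvd_conductorNorm_of_isTorsionGaloisRep (W W' : WeierstrassCurve ℚ) [W.IsElliptic]
    [W'.IsElliptic] {ℓ : ℕ} [Fact ℓ.Prime] (hℓ4 : 4 < ℓ) {ρ : ModPGaloisRep ℚ (ZMod ℓ) 2}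
    (hρ : W.IsTorsionGaloisRep ℓ ρ) (hρ' : W'.IsTorsionGaloisRep ℓ ρ) {p : ℕ} (hp : p.Prime)
    (hpℓ : p ≠ ℓ) (hW : ¬ p ^ 2 ∣ W.conductorNorm ℤ) : ¬ p ^ 2 ∣ W'.conductorNorm ℤ := by
  sorry

/-- **H2 (M) — at a prime `v ∤ 3` of good or multiplicative reduction, hypothesis (ii) holds with
its first two disjuncts**: `ρ̄_{E,3}` is unramified at `𝔓`, or `ρ̄(D_𝔓)` has a common eigenvector
(over `𝔽₃` even).  Route: `exists_ne_zero_smul_eq_of_not_hasAdditiveReductionAt` gives `P ≠ 0` in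
`E[3]` fixed by `I_𝔓`; `det ρ̄ = χ̄₃` is unramified at `v ∤ 3` (as in `det_eq_one_of_mem_inertia_two`),
so `ρ̄(I_𝔓) ≤ U_P ≅ C₃`; either `ρ̄(I_𝔓) = 1`, or `D_𝔓 ⊵ I_𝔓` normalises `U_P` and F2 makes the
frame image of `P` a common eigenvector. -/
theorem unramified_or_hasCommonEigenvectorOn_of_not_hasAdditiveReductionAt (W : WeierstrassCurve ℚ)
    [W.IsElliptic] {ρ : ModPGaloisRep ℚ (ZMod 3) 2} (hρ : W.IsTorsionGaloisRep 3 ρ)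
    {v : HeightOneSpectrum (𝓞 ℚ)} (hv3 : (3 : 𝓞 ℚ) ∉ v.asIdeal) (hW : ¬ W.HasAdditiveReductionAt v)
    {𝔓 : Ideal (absIntegers (𝓞 ℚ) ℚ)} (h𝔓 : 𝔓 ∈ v.primesAbove) :
    (∀ σ ∈ 𝔓.inertia (absoluteGaloisGroup ℚ), ρ σ = 1) ∨
      HasCommonEigenvectorOn ρ (MulAction.stabilizer (absoluteGaloisGroup ℚ) 𝔓) := by
  sorry

/-- **H3 (S given F1) — the additive Frey classes are absolutely irreducible on inertia at `2`**:
for a normalised pair (`A ≡ -1 (mod 4)`, `2 ∣ B`, `16 ∤ B`, `2A + B ≠ 0`) and any framed model `ρ̄`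
of `E_(A,B)[3]`, at the prime `𝔓 ∣ 2` of S6 `ρ̄(I_𝔓)` has NO common eigenvector over `𝔽₉`.
Route: `stub_freySwanOdd` (`Sw_𝔓(E[5]) ∈ {1,3}`), `swanConductorAt_torsion_eq_swanConductorAt_torsion
3 5` (`ℓ`-independence), `stub_swanOddNonabelianInertia` (two inertia elements not commuting on
`E[3]`), transport to the frame as in `exists_orderOf_eq_eight_of_inertia_noncomm`,
`det_eq_one_of_mem_inertia_two`, and F1.  Payoff (informal, DDT 1995 §2): `(ad⁰ρ̄)^{I_2} = 0`, so
`H¹(ℚ₂, ad⁰ρ̄) = 0` by the local Euler characteristic — `ρ̄|G_{ℚ₂}` is rigid, `2 ∉ Σ`.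
[cite: DiamondKramer1995, Lemmas 2–3] -/
theorem not_hasCommonEigenvectorOn_inertia_two_freyCurve_additive :
    ∀ (A B : ℤ) [(freyCurve A B).IsElliptic], IsCoprime A B → A * B * (A + B) ≠ 0 →
      A ≡ -1 [ZMOD 4] → (2 : ℤ) ∣ B → ¬ (16 : ℤ) ∣ B → 2 * A + B ≠ 0 →
      ∀ ρ : ModPGaloisRep ℚ (ZMod 3) 2, (freyCurve A B).IsTorsionGaloisRep 3 ρ →
      ∃ (v : HeightOneSpectrum (𝓞 ℚ)) (𝔓 : Ideal (absIntegers (𝓞 ℚ) ℚ)),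
        (2 : 𝓞 ℚ) ∈ v.asIdeal ∧ 𝔓 ∈ v.primesAbove ∧
        ¬ HasCommonEigenvectorOn ρ (𝔓.inertia (absoluteGaloisGroup ℚ)) := by
  sorry

/-- **H4 (S) — twisting by a character preserves common eigenvectors** (the `-1`-twist transport at
`q = 2` for un-normalised pairs: `E_(b,a) = E_(a,b)^{(-1)}`, `quadraticTwist_freyCurve_neg_one`, and
the framed twist model `isTorsionGaloisRep_quadraticTwist_twist`). -/
theorem hasCommonEigenvectorOn_of_forall_eq_smul (ρ ρ' : ModPGaloisRep ℚ (ZMod 3) 2)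
    (S : Set (absoluteGaloisGroup ℚ))
    (hχ : ∀ σ ∈ S, ∃ c : ZMod 3, ((ρ' σ : GL (Fin 2) (ZMod 3)) : Matrix (Fin 2) (Fin 2) (ZMod 3)) =
      c • ((ρ σ : GL (Fin 2) (ZMod 3)) : Matrix (Fin 2) (Fin 2) (ZMod 3)))
    (h : HasCommonEigenvectorOn ρ S) : HasCommonEigenvectorOn ρ' S := by
  sorry

/-- **H7 (M) — hypothesis (ii) at a prime `q ≡ 5 (mod 12)` holds for EVERY elliptic curve over `ℚ`
and every framed model of `E[3]`** (in particular at `q = 5` for the switched curve `W'`, whatever its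
reduction there).  Route: wild inertia at `q ∤ 6` dies in `GL₂(𝔽₃)` (order `48`), so `ρ̄(I_𝔓) = ⟨t⟩`
is cyclic with `det t = 1`; a Frobenius `φ ∈ D_𝔓` conjugates tame inertia by `σ ↦ σ^q`
(`exists_mem_primesAbove_isArithFrobAt_absGalConjBy`-type machinery of
`Literature/NumberTheory/GaloisRepresentations/AbsGaloisConjByFrobeniusAt.lean`); `ρ̄(D_𝔓)` is
generated by `t` and `ρ̄(φ)`; F3. -/
theorem wilesVexingHyp_at_five_mod_twelve (W : WeierstrassCurve ℚ) [W.IsElliptic]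
    {ρ : ModPGaloisRep ℚ (ZMod 3) 2} (hρ : W.IsTorsionGaloisRep 3 ρ) (v : HeightOneSpectrum (𝓞 ℚ))
    (hq : (Rat.HeightOneSpectrum.primesEquiv v : ℕ) % 12 = 5) :
    ∃ 𝔓 ∈ v.primesAbove,
      (∀ σ ∈ 𝔓.inertia (absoluteGaloisGroup ℚ), ρ σ = 1) ∨
      HasCommonEigenvectorOn ρ (MulAction.stabilizer (absoluteGaloisGroup ℚ) 𝔓) := by
  sorry

/-- **H5 (M) — branch (a): every framed model of `E_(a,b)[3]` satisfies Wiles' hypothesis (ii)**,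
for EVERY coprime pair (no normalisation).  Odd `q`: H0 + H2.  `q = 2`: reduce to a normalised pair
`(A, B)` along translations and the `-1` twist (`exists_normalised_freyCurve_caseB`-style bookkeeping of
`DefiniteXiFreyModularityStubFreyCaseBAllPairs`, H4); then `16 ∣ B`: semistable at `2`, H2;
`16 ∤ B`, `2A + B ≠ 0`: H3 (third disjunct); the corner `2A + B = 0` (`E_(-1,2)`, `N = 32`,
`f₂ = 5 = 2 + Sw`, `Sw = 3` odd): S11 again. -/
theorem wilesVexingHyp_freyCurve :
    ∀ (a b : ℤ) [(freyCurve a b).IsElliptic], IsCoprime a b → a * b * (a + b) ≠ 0 →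
      ∀ ρ : ModPGaloisRep ℚ (ZMod 3) 2, (freyCurve a b).IsTorsionGaloisRep 3 ρ →
      WilesVexingHyp ρ := by
  sorry

/-- **H6 (M) — branch (b): every framed model of `W'[3]` satisfies (ii), for ANY curve `W'` with
`W'[5] ≅ E_(a,b)[5]` (the registered `stub_switch` unchanged).**  Odd `q ≡ 2 (mod 3)`, `q ≠ 5`: `E` is
semistable at `q` (H0), hence so is `W'` (H1 at `ℓ = 5`, `q ≠ 5`), then H2; `q = 5`: H7 (`5 ≡ 5 mod
12`); `q = 2`: a case-B `E` is, up to translation and the swap `E_(b,a) = E_(a,b)^{(-1)}`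
(`exists_normalised_freyCurve_caseB`, `quadraticTwist_freyCurve_neg_one`), a normalised `E_(A,B)` with
`16 ∣ B` (S12), semistable at `2` (`isSemistable_freyCurve_of_sixteen_dvd`); H1 on the twisted pair via
the framed twist model `isTorsionGaloisRep_quadraticTwist_twist` (`E^{(-1)}[5] ≅ ρ ⊗ χ₋₁ ≅ W'^{(-1)}[5]`),
then H2 for `W'` or `W'^{(-1)}` and H4.  (A sharpened switch "`E'` semistable at `5`", Wiles 1995
pp. 543–544, was considered and is NOT needed: F3.) -/
theorem wilesVexingHyp_of_switch :
    ∀ (a b : ℤ) [(freyCurve a b).IsElliptic], IsCoprime a b → a * b * (a + b) ≠ 0 →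
      ∀ (W' : WeierstrassCurve ℚ) [W'.IsElliptic] (ρ : ModPGaloisRep ℚ (ZMod 5) 2),
      (freyCurve a b).IsTorsionGaloisRep 5 ρ → W'.IsTorsionGaloisRep 5 ρ →
      ∀ ρ₃' : ModPGaloisRep ℚ (ZMod 3) 2, W'.IsTorsionGaloisRep 3 ρ₃' → WilesVexingHyp ρ₃' := by
  sorry

/-! ## Assembly sketch: with S1b♭ in place of S1b (S3 unchanged) the composition still closes —
branch (a) feeds `h1♭ (freyCurve a b) ρ₃ hρ₃ h3i h9 (H5 a b hab h0 ρ₃ hρ₃) (h0 ρ₃ h3i)`, branch (b)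
feeds `h1♭ W' ρ₃' hρ₃' h3i' (stub_nineTransfer …) (H6 a b hab h0 W' ρ hρ hρ' ρ₃' hρ₃') (h0 ρ₃' h3i')`.  Typed witness that the
two Props compose with the skeleton's other atoms exactly as before (modularity at `3`, the
composite shape `isModular_of_stubs_three` of the skeleton, now from S1b♭ + (ii)): -/
theorem isModularGaloisRepTate_three_of_liftThreeWiles (h1 : LiftThreeWiles)
    (h0 : ∀ ρ : ModPGaloisRep ℚ (ZMod 3) 2, ρ.IsAbsIrreducibleOverSqrt (-3) → ρ.IsModular)
    (W : WeierstrassCurve ℚ) [W.IsElliptic] (ρ : ModPGaloisRep ℚ (ZMod 3) 2)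
    (hρ : W.IsTorsionGaloisRep 3 ρ) (h3i : ρ.IsAbsIrreducibleOverSqrt (-3))
    (h9 : ¬ 9 ∣ W.conductorNorm ℤ) (hii : WilesVexingHyp ρ) : W.IsModularGaloisRepTate 3 :=
  h1 W ρ hρ h3i h9 hii (h0 ρ h3i)

end Summit.ABC.ABC.Cruxes.FreyModularity.StubIdeas3G5

end
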